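import Mathlib.Algebra.MvPolynomial.Funext
import Literature.Barriers.ValiantsHypothesis.BILPS19MembershipHardness
import Literature.Computability.AlgebraicComplexity.KIReductionCodes
import Literature.Computability.AlgebraicComplexity.DeterminantalIdealComplexityDescent
import HarnessLib

/-!
# Bläser–Ikenmeyer–Lysikov–Pandey–Schreyer 2019, Cor 42: the `∃BPP` verifier's two identity-test
# instances — layout and semantics

Theorem-only companion of `BILPS19MembershipHardness.lean` (typed fact `BILPS2019_cor42`, the
minrank instance of BILPS Thm 40: "unless `coNP ⊆ ∃BPP`" there are no `poly(n)`-natural proofs for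
minrank). The printed proof of Thm 40 (arXiv:1911.02534, p0035:L1–L20) puts the complement of the
NP-hard membership problem (`HMinRank1`, Cor 35) in `∃BPP`: "guess a circuit `C` of polynomial size …
use polynomial identity testing to check whether `C(g_1, …, g_{p(n)})` is identically zero … then
evaluate `C` at the given point". This file writes, for an `HMinRank1` instance and a guessed gate
list, the TWO division-free integer circuits whose identity tests the verifier runs, and proves what
they compute:

* the guessed circuit is a gate list `B : KBlock` of the tree's Kabanets–Impagliazzo machinery
  (`KIReductionInstance.lean`: `useGates`, `blockPoly N B` — its polynomial in the `N = k·n²` tensor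
  coordinates); `toKBlockFin` converts an honest fan-in-two sign-constant circuit over `Fin N` into
  such a list (`blockPoly_toKBlockFin`, the `Fin N` twin of KI's `blockPoly_toKBlock`), and
  `exists_kblock_of_circuit` descends a sign-constant circuit over a field of characteristic `0`
  to it (`ArithCircuit.mapConsts`, `map_mapConsts_eq_self`);
* `chartCircuit k n B` — ONE identity-test instance for all `k` rank-one pencil charts `φ_{a₀}` of
  `𝓜_1` (`BILPS19MinrankOnePencilCover.lean`): in the variables `S, x, u, v` of the charts and `k`
  fresh variables `y`, it computes `Σ_{a₀} y_{a₀} · blockPoly(φ_{a₀})` (`eval_chartCircuit`), which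
  is `0` iff every chart substitution of `blockPoly` is (`chartSum_eq_zero_iff`);
* `evalCircuit N c B` — the closed circuit computing `blockPoly` at an integer point `c`
  (`eval_evalCircuit`); `padEntry` is the zero-padded tensor of an instance.

Both circuits end with a ballast of empty gates so that their code words are at least as long as
their number of variables (the side condition of the tree's randomised identity test on circuit
codes, `CircuitCode.semPoly_circuitWord_eq_zero_iff`). The string machine writing their codes and
the `∃·BPP` assembly are the sibling files `BILPS19Cor42Machine.lean` / `BILPS19Cor42OfPIT.lean`.
Theorem-only file (its `def`s are proof plumbing: layouts and gate lists); no statement of the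
barrier file is touched, no new fact. HONEST FRAMING (val-lit): Boolean/algebraic plumbing of a
printed `∃BPP` verifier; `VP ≠ VNP` is NOT proved and nothing here bears on it.

## References

* [BlaserIkenmeyerLysikovPandeySchreyer2019] M. Bläser, C. Ikenmeyer, V. Lysikov, A. Pandey,
  F.-O. Schreyer, *Variety membership testing, algebraic natural proofs, and geometric complexity
  theory*, arXiv:1911.02534, §8.3: Thm. 40 (proof, p0035:L1–L20), Lemma 41, Cor. 42 (p0035:L37).
* [KabanetsImpagliazzo2003] V. Kabanets, R. Impagliazzo, *Derandomizing polynomial identity tests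
  means proving circuit lower bounds*, STOC 2003, proof of Cor. 12 (p. 358) (guessed gate lists).
* [Burgisser2000] P. Bürgisser, *Completeness and Reduction in Algebraic Complexity Theory*,
  Springer 2000, Def. 2.1, Rem. 2.7 (straight-line programs, substitution), §4.1 (scalars).
-/

noncomputable section

open MvPolynomial

namespace Literature.Barriers.ValiantsHypothesis

namespace BILPS2019Cor42

open Literature.Computability.AlgebraicComplexity ArithCircuit KIReduction

/-! ### §1. Honest circuits over `Fin N` as guessed gate lists -/

section ToKBlock

variable {N : ℕ}

/-- Conversion of an operand of a circuit over the `N` input positions, at gate number `t`: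
variables are input positions, references to earlier gates become block references, junk
references and constants outside `{1, -1}` become `0`. [cite: KabanetsImpagliazzo2003, proof of Cor. 12 (p. 358)] -/
def toKOpFin (t : ℕ) : Operand ℤ (Fin N) → KOp
  | .var i => .ref i.val
  | .gate j => if j < t then .ref (N + j) else .zero
  | .const c => if c = 1 then .one else if c = -1 then .negOne else .zero

/-- Conversion of gate number `t` of a fan-in-two circuit (junk for larger fan-in). [cite: KabanetsImpagliazzo2003, proof of Cor. 12 (p. 358)] -/
def toKGateFin (t : ℕ) : Gate ℤ (Fin N) → KGate
  | .sum [] => ⟨.add, .zero, .zero⟩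
  | .sum [(c, u)] => sumTwo c 0 (toKOpFin t u) .zero
  | .sum [(c₁, u₁), (c₂, u₂)] => sumTwo c₁ c₂ (toKOpFin t u₁) (toKOpFin t u₂)
  | .sum (_ :: _ :: _ :: _) => ⟨.add, .zero, .zero⟩
  | .prod [] => ⟨.mul, .one, .one⟩
  | .prod [u] => ⟨.mul, toKOpFin t u, .one⟩
  | .prod [u₁, u₂] => ⟨.mul, toKOpFin t u₁, toKOpFin t u₂⟩
  | .prod (_ :: _ :: _ :: _) => ⟨.mul, .one, .one⟩

/-- **The guessed gate list of a circuit over `Fin N`**: its gates converted in order, then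
`output + 0`. [cite: KabanetsImpagliazzo2003, proof of Cor. 12 (p. 358)] -/
def toKBlockFin (C : ArithCircuit ℤ (Fin N)) : KBlock :=
  C.gates.mapIdx toKGateFin ++ [⟨.add, toKOpFin C.size C.output, .zero⟩]

/-- Length of the converted list: one more than the size. [cite: KabanetsImpagliazzo2003, proof of Cor. 12 (p. 358)] -/
@[simp] theorem length_toKBlockFin (C : ArithCircuit ℤ (Fin N)) :
    (toKBlockFin C).length = C.size + 1 := by
  simp [toKBlockFin, size]

/-- **Operand lemma**: a converted operand, realised at `1` and read against the prefix values
followed by the values of the first `t` gates, is the value of the operand (sign constants).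
[cite: KabanetsImpagliazzo2003, proof of Cor. 12 (p. 358)] -/
theorem eval_toKOpFin (u : Operand ℤ (Fin N)) (hu : u.HasSignConstants)
    (vals : List (MvPolynomial (Fin N) ℤ)) :
    ((toKOpFin vals.length u).toOperand 1 : Operand ℤ (Fin N)).eval (gateValues (idPre N) ++ vals) =
      u.eval vals := by
  cases u with
  | var i =>
    simp only [toKOpFin, KOp.toOperand, Operand.eval, List.getD_eq_getElem?_getD]
    rw [getElem?_gateValues_idPre i.isLt]
    rfl
  | const c =>
    have e : c = 0 ∨ c = 1 ∨ c = -1 := by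
      rcases hu with h | h | h <;> [exact Or.inl h; exact Or.inr (Or.inl h); exact Or.inr (Or.inr (by omega))]
    rcases e with rfl | rfl | rfl <;> simp [toKOpFin, KOp.toOperand, Operand.eval]
  | gate j =>
    by_cases hj : j < vals.length
    · simp only [toKOpFin, hj, if_true, KOp.toOperand, Operand.eval, List.getD_eq_getElem?_getD]
      rw [List.getElem?_append_right (by rw [length_gateValues_idPre]; omega),
        length_gateValues_idPre, show 1 + (N + j) - (N + 1) = j by omega, List.getElem?_eq_getElem hj]
    · simp only [toKOpFin, hj, if_false]
      rw [eval_toOperand_zero, Operand.eval_gate, List.getD_eq_getElem?_getD,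
        List.getElem?_eq_none (by omega)]
      simp

/-- **Gate lemma**: a converted fan-in-two gate with sign constants, realised at `1`, computes the
value of the gate. [cite: KabanetsImpagliazzo2003, proof of Cor. 12 (p. 358)] -/
theorem eval_toKGateFin (g : Gate ℤ (Fin N)) (h2 : g.fanIn ≤ 2) (hs : g.HasSignConstants)
    (vals : List (MvPolynomial (Fin N) ℤ)) :
    ((toKGateFin vals.length g).toGate 1 : Gate ℤ (Fin N)).eval (gateValues (idPre N) ++ vals) =
      g.eval vals := by
  cases g with
  | sum args =>
    match args, h2, hs with
    | [], _, _ => simp [toKGateFin, KGate.toGate, KOp.toOperand, Gate.eval, Operand.eval]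
    | [(c, u)], _, hs =>
      have hc := (hs (c, u) (by simp)).1
      have hu := (hs (c, u) (by simp)).2
      simp only [toKGateFin]
      rw [eval_sumTwo hc isSignConstant_zero, eval_toKOpFin u hu]
      simp [Gate.eval]
    | [(c₁, u₁), (c₂, u₂)], _, hs =>
      have h₁ := hs (c₁, u₁) (by simp)
      have h₂ := hs (c₂, u₂) (by simp)
      simp only [toKGateFin]
      rw [eval_sumTwo h₁.1 h₂.1, eval_toKOpFin u₁ h₁.2, eval_toKOpFin u₂ h₂.2]
      simp [Gate.eval]
    | _ :: _ :: _ :: _, h2, _ => simp [Gate.fanIn, Gate.args] at h2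
  | prod args =>
    match args, h2, hs with
    | [], _, _ => simp [toKGateFin, KGate.toGate, KOp.toOperand, Gate.eval, Operand.eval]
    | [u], _, hs =>
      simp only [toKGateFin, eval_toGate]
      rw [eval_toKOpFin u (hs u (by simp))]
      simp [Gate.eval]
    | [u₁, u₂], _, hs =>
      simp only [toKGateFin, eval_toGate]
      rw [eval_toKOpFin u₁ (hs u₁ (by simp)), eval_toKOpFin u₂ (hs u₂ (by simp))]
      simp [Gate.eval]
    | _ :: _ :: _ :: _, h2, _ => simp [Gate.fanIn, Gate.args] at h2

/-- **Value-list lemma**: behind the identity layer, the converted gates of a fan-in-two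
constant-free circuit have the value list of the circuit. [cite: KabanetsImpagliazzo2003, proof of Cor. 12 (p. 358)] -/
theorem gateValues_idPre_append_mapIdx_fin (gs : List (Gate ℤ (Fin N)))
    (h2 : ∀ g ∈ gs, g.fanIn ≤ 2) (hs : ∀ g ∈ gs, g.HasSignConstants) :
    gateValues (idPre N ++ (gs.mapIdx toKGateFin).map (KGate.toGate 1)) =
      gateValues (idPre N) ++ gateValues gs := by
  induction gs using List.reverseRecOn with
  | nil => simp [gateValues]
  | append_singleton gs g ih =>
    have ih' := ih (fun g' hg' => h2 g' (by simp [hg'])) (fun g' hg' => hs g' (by simp [hg']))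
    rw [List.mapIdx_concat, List.map_append, List.map_singleton, ← List.append_assoc,
      gateValues_append_singleton, ih', gateValues_append_singleton, List.append_assoc]
    have hlen : gs.length = (gateValues gs).length := (gateValues_length gs).symm
    rw [hlen, eval_toKGateFin g (h2 g (by simp)) (hs g (by simp)) (gateValues gs)]

/-- **The converted list computes the circuit**: for a fan-in-two constant-free circuit `C` over
`Fin N`, `blockPoly N (toKBlockFin C) = C.eval`. [cite: KabanetsImpagliazzo2003, proof of Cor. 12 (p. 358)] -/
theorem blockPoly_toKBlockFin (C : ArithCircuit ℤ (Fin N)) (h2 : C.IsFanInTwo)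
    (hs : C.HasSignConstants) : blockPoly N (toKBlockFin C) = C.eval := by
  unfold blockPoly
  rw [useGates_idLayer_eq, toKBlockFin, List.map_append, List.map_singleton, ← List.append_assoc,
    show useOut N (C.gates.mapIdx toKGateFin ++ [(⟨.add, toKOpFin C.size C.output, .zero⟩ : KGate)]) =
      (idPre N ++ (C.gates.mapIdx toKGateFin).map (KGate.toGate 1)).length by
        simp [useOut, idPre, size]; omega,
    valueAt_append_singleton, gateValues_idPre_append_mapIdx_fin C.gates h2 hs.1, eval_toGate]
  simp only
  rw [eval_toOperand_zero, add_zero, show C.size = (gateValues C.gates).length by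
    rw [gateValues_length]; rfl, eval_toKOpFin C.output hs.2]
  rfl

/-- Converted operands refer below `N + t + 1`. [folklore] -/
private theorem idx_toKOpFin_lt (t : ℕ) (u : Operand ℤ (Fin N)) : (toKOpFin t u).idx < N + t + 1 := by
  cases u with
  | var i => have := i.isLt; simp only [toKOpFin, KOp.idx]; omega
  | const c => simp only [toKOpFin]; split_ifs <;> simp [KOp.idx]
  | gate j =>
    simp only [toKOpFin]
    split_ifs with h
    · simp only [KOp.idx]; omega
    · simp [KOp.idx]

/-- Converted gates refer below `N + t + 1`. [folklore] -/
private theorem idx_toKGateFin_lt (t : ℕ) (g : Gate ℤ (Fin N)) :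
    (toKGateFin t g).a.idx < N + t + 1 ∧ (toKGateFin t g).b.idx < N + t + 1 := by
  have hop := idx_toKOpFin_lt (N := N) t
  cases g with
  | sum args =>
    match args with
    | [] => simp [toKGateFin, KOp.idx]
    | [(c, u)] =>
      have h := idx_sumTwo_le c 0 (toKOpFin t u) .zero
      have hu := hop u
      have hz : KOp.zero.idx = 0 := rfl
      rw [hz, Nat.max_zero] at h
      simp only [toKGateFin]
      omega
    | [(c₁, u₁), (c₂, u₂)] =>
      have h := idx_sumTwo_le c₁ c₂ (toKOpFin t u₁) (toKOpFin t u₂)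
      have hu₁ := hop u₁
      have hu₂ := hop u₂
      simp only [toKGateFin]
      omega
    | _ :: _ :: _ :: _ => simp [toKGateFin, KOp.idx]
  | prod args =>
    match args with
    | [] => simp [toKGateFin, KOp.idx]
    | [u] => exact ⟨by simpa [toKGateFin] using hop u, by simp [toKGateFin, KOp.idx]⟩
    | [u₁, u₂] => exact ⟨by simpa [toKGateFin] using hop u₁, by simpa [toKGateFin] using hop u₂⟩
    | _ :: _ :: _ :: _ => simp [toKGateFin, KOp.idx]

/-- **References of a converted list stay inside its use**: every operand refers below
`N + |toKBlockFin C|`. [folklore] -/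
private theorem idx_lt_of_mem_toKBlockFin (C : ArithCircuit ℤ (Fin N)) {g : KGate} (hg : g ∈ toKBlockFin C) :
    g.a.idx < N + (toKBlockFin C).length ∧ g.b.idx < N + (toKBlockFin C).length := by
  rw [length_toKBlockFin]
  simp only [toKBlockFin, List.mem_append, List.mem_mapIdx, List.mem_singleton] at hg
  rcases hg with ⟨t, ht, rfl⟩ | rfl
  · have h := idx_toKGateFin_lt (N := N) t (C.gates[t])
    have : t < C.size := ht
    omega
  · have h := idx_toKOpFin_lt (N := N) C.size C.output
    exact ⟨show (toKOpFin C.size C.output).idx < N + (C.size + 1) by omega,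
      show KOp.zero.idx < N + (C.size + 1) by simp [KOp.idx]⟩

end ToKBlock

/-! ### §2. Gate-list tools: value-independent gates, uses behind gate-reference layers -/

section Tools

variable {τ : Type*}

/-- The value list of `pre ++ gs` is the fold of `gs` started on the values of `pre`. [folklore] -/
private theorem gateValues_append_eq_foldl (pre gs : List (Gate ℤ τ)) :
    gateValues (pre ++ gs) = gs.foldl (fun vals g => vals ++ [g.eval vals]) (gateValues pre) := by
  simp [gateValues, List.foldl_append]

/-- Appending value-independent gates appends their (fixed) values. [folklore] -/
private theorem gateValues_append_of_forall (pre gs : List (Gate ℤ τ)) (f : Gate ℤ τ → MvPolynomial τ ℤ)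
    (h : ∀ g ∈ gs, ∀ vals, g.eval vals = f g) : gateValues (pre ++ gs) = gateValues pre ++ gs.map f := by
  induction gs using List.reverseRecOn with
  | nil => simp
  | append_singleton gs g ih =>
    rw [← List.append_assoc, gateValues_append_singleton, ih (fun g' hg' => h g' (by simp [hg'])),
      List.map_append, List.map_singleton, List.append_assoc, h g (by simp)]

/-- Reading position `pre.length + j` of `gateValues pre ++ ws`. [folklore] -/
private theorem getD_gateValues_append (pre : List (Gate ℤ τ)) (ws : List (MvPolynomial τ ℤ)) (j : ℕ) :
    (gateValues pre ++ ws).getD (pre.length + j) 0 = ws.getD j 0 := by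
  rw [List.getD_eq_getElem?_getD, List.getD_eq_getElem?_getD,
    List.getElem?_append_right (by rw [gateValues_length]; omega), gateValues_length,
    Nat.add_sub_cancel_left]

/-- **A use of the block `B` behind a layer of gate references**, placed at absolute index `base`:
the guard gate `0`, the `N` layer gates `1 • gate (refs i)` (copies of earlier gates), and the
block with `ref i ↦ gate (base + 1 + i)`. [cite: KabanetsImpagliazzo2003, proof of Cor. 12 (p. 358)] -/
def useGatesRef (base : ℕ) (refs : ℕ → ℕ) (N : ℕ) (B : KBlock) : List (Gate ℤ τ) :=
  Gate.sum [] :: ((List.range N).map (fun i => Gate.sum [(1, .gate (refs i))]) ++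
    B.map (KGate.toGate (base + 1)))

/-- A use has `1 + N + |B|` gates. [cite: KabanetsImpagliazzo2003, proof of Cor. 12 (p. 358)] -/
@[simp] theorem length_useGatesRef (base : ℕ) (refs : ℕ → ℕ) (N : ℕ) (B : KBlock) :
    (useGatesRef base refs N B : List (Gate ℤ τ)).length = N + B.length + 1 := by
  simp only [useGatesRef, List.length_cons, List.length_append, List.length_map, List.length_range]

/-- A use behind gate references is the substitution `X i ↦ gate (refs i)` (shifted by `base`) into
the use behind the identity layer. [cite: Burgisser2000, Rem. 2.7] -/
theorem useGatesRef_eq_map_subst (base : ℕ) (refs : ℕ → ℕ) (N : ℕ) (B : KBlock) :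
    (useGatesRef base refs N B : List (Gate ℤ τ)) =
      (useGates 0 (idLayer N) B).map (Gate.subst (fun i : Fin N => (Operand.gate (refs i) : Operand ℤ τ)) base) := by
  have hl : (List.ofFn fun i : Fin N => layerGate (idLayer N i)).map
      (Gate.subst (fun i : Fin N => (Operand.gate (refs i) : Operand ℤ τ)) base) =
      (List.range N).map (fun i => Gate.sum [(1, .gate (refs i))]) := by
    apply List.ext_getElem
    · simp
    · intro j h₁ h₂
      simp [layerGate, idLayer, LayerEntry.toOperand, Gate.subst, Operand.subst]
  simp only [useGatesRef, useGates, List.map_cons, List.map_append, List.map_map, Function.comp_def,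
    sum_nil_subst, KGate.toGate_subst, Nat.zero_add, ← hl]

/-- **Use lemma for gate-reference layers.** Inside any gate list, the output of a use of `B`
behind references `refs i < |pre|` placed at `|pre|` has the value `blockPoly N B` taken at the
referenced values — whatever follows the use. [cite: KabanetsImpagliazzo2003, proof of Cor. 12 (p. 358)] -/
theorem valueAt_useGatesRef (pre post : List (Gate ℤ τ)) {refs : ℕ → ℕ} {N : ℕ}
    (hrefs : ∀ i < N, refs i < pre.length) (B : KBlock) :
    valueAt (pre ++ useGatesRef pre.length refs N B ++ post) (pre.length + useOut N B) =
      aeval (fun i : Fin N => valueAt pre (refs i)) (blockPoly N B) := by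
  rw [valueAt_append_left _ _ (by simp [useOut]), valueAt, gateValues_append_eq_foldl,
    useGatesRef_eq_map_subst]
  have hlen : pre.length = (gateValues pre).length := (gateValues_length pre).symm
  have hρ : ∀ (i : Fin N) (ws : List (MvPolynomial τ ℤ)),
      ((fun i : Fin N => (Operand.gate (refs i) : Operand ℤ τ)) i).eval (gateValues pre ++ ws) =
        valueAt pre (refs i) := fun i ws => eval_gate_append pre ws (hrefs i i.isLt)
  have h := foldl_subst (k := ℤ) (pre := gateValues pre) hρ (useGates 0 (idLayer N) B) []
  simp only [List.map_nil, List.append_nil] at h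
  rw [← hlen] at h
  rw [h, List.getD_eq_getElem?_getD, List.getElem?_append_right (by rw [← hlen]; omega), ← hlen,
    Nat.add_sub_cancel_left, List.getElem?_map]
  unfold blockPoly valueAt
  rw [List.getD_eq_getElem?_getD]
  change (Option.map _ (gateValues (useGates 0 (idLayer N) B))[useOut N B]?).getD 0 = _
  cases (gateValues (useGates 0 (idLayer N) B))[useOut N B]? <;> simp

end Tools

/-! ### §3. Layout of the identity-test variables -/

section Layout

variable (k n : ℕ)

/-- Number of tensor coordinates `S_{abc}` / input positions of the guessed block: `N = k n²`
(position of `(a, b, c)` is `a n² + b n + c`). [cite: BlaserIkenmeyerLysikovPandeySchreyer2019, Problem 2 (input)] -/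
def nIn : ℕ := k * n ^ 2

/-- Number of variables of the chart test: `S` (`k n²`), `x` (`k`), `u` (`n`), `v` (`n`), `y` (`k`).
[cite: BlaserIkenmeyerLysikovPandeySchreyer2019, Thm. 40 (proof)] -/
def nVar : ℕ := k * n ^ 2 + k + n + n + k

/-- Index of the pencil coefficient `x_a`. [folklore] -/
def xIdx (a : ℕ) : ℕ := k * n ^ 2 + a

/-- Index of the rank-one factor `u_b`. [folklore] -/
def uIdx (b : ℕ) : ℕ := k * n ^ 2 + k + b

/-- Index of the rank-one factor `v_c`. [folklore] -/
def vIdx (c : ℕ) : ℕ := k * n ^ 2 + k + n + c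

/-- Index of the fresh multiplier `y_a` of chart `a`. [folklore] -/
def yIdx (a : ℕ) : ℕ := k * n ^ 2 + k + n + n + a

/-- The operand "variable number `i`" of a circuit in `M` variables (junk `0` out of range). [folklore] -/
def varOp (M i : ℕ) : Operand ℤ (Fin M) := if h : i < M then .var ⟨i, h⟩ else .const 0

/-- The polynomial "variable number `i`" in `M` variables (junk `0` out of range). [folklore] -/
def varP (M i : ℕ) : MvPolynomial (Fin M) ℤ := if h : i < M then X ⟨i, h⟩ else 0

/-- `varOp` evaluates to `varP` against any value list. [cite: Burgisser2000, Def. 2.1] -/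
@[simp] theorem eval_varOp (M i : ℕ) (vals : List (MvPolynomial (Fin M) ℤ)) :
    (varOp M i).eval vals = varP M i := by
  unfold varOp varP
  split_ifs <;> simp [Operand.eval]

end Layout

/-! ### §4. The chart-test circuit -/

section Chart

variable (k n : ℕ)

/-- Product gate `u_b · v_c` for input position `i` (`b = (i / n) % n`, `c = i % n`). [cite: BlaserIkenmeyerLysikovPandeySchreyer2019, Thm. 40 (proof: the parametrisation)] -/
def prodUV (i : ℕ) : Gate ℤ (Fin (nVar k n)) :=
  .prod [varOp _ (uIdx k n ((i / n) % n)), varOp _ (vIdx k n (i % n))]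

/-- Product gate `x_{a'} · S_{a' b c}` for input position `i`. [cite: BlaserIkenmeyerLysikovPandeySchreyer2019, Thm. 40 (proof: the parametrisation)] -/
def prodXS (i a' : ℕ) : Gate ℤ (Fin (nVar k n)) :=
  .prod [varOp _ (xIdx k n a'), varOp _ (a' * n ^ 2 + ((i / n) % n) * n + i % n)]

/-- The coordinate gate of chart `a₀` at input position `i`, its products sitting at `p, …, p + k`:
`u_b v_c − Σ_{a' ≠ a₀} x_{a'} S_{a' b c}` on the slice `a₀`, the variable `S_{abc}` elsewhere.
[cite: BlaserIkenmeyerLysikovPandeySchreyer2019, Thm. 40 (proof: the parametrisation)] -/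
def coordGate (a₀ i p : ℕ) : Gate ℤ (Fin (nVar k n)) :=
  if i / n ^ 2 = a₀ then
    .sum ((1, .gate p) :: (List.range k).map fun a' => (if a' = a₀ then 0 else -1, .gate (p + 1 + a')))
  else .sum [(1, varOp _ i)]

/-- The `k + 2` gates of chart `a₀` at input position `i`, placed at `p`. [cite: BlaserIkenmeyerLysikovPandeySchreyer2019, Thm. 40 (proof)] -/
def coordBlock (a₀ i p : ℕ) : List (Gate ℤ (Fin (nVar k n))) :=
  prodUV k n i :: ((List.range k).map (prodXS k n i) ++ [coordGate k n a₀ i p])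

/-- Length of a coordinate block. [cite: Burgisser2000, Def. 2.1] -/
@[simp] theorem length_coordBlock (a₀ i p : ℕ) : (coordBlock k n a₀ i p).length = k + 2 := by
  simp [coordBlock]

/-- All coordinate gates of chart `a₀` (input positions `0, …, m-1`), starting at `base`. [cite: BlaserIkenmeyerLysikovPandeySchreyer2019, Thm. 40 (proof)] -/
def coords (a₀ base m : ℕ) : List (Gate ℤ (Fin (nVar k n))) :=
  (List.range m).flatMap fun i => coordBlock k n a₀ i (base + i * (k + 2))

/-- Length of the coordinate gates. [cite: Burgisser2000, Def. 2.1] -/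
@[simp] theorem length_coords (a₀ base m : ℕ) : (coords k n a₀ base m).length = m * (k + 2) := by
  induction m with
  | zero => simp [coords]
  | succ m ih =>
    simp only [coords, List.range_succ, List.flatMap_append, List.flatMap_singleton, List.length_append,
      length_coordBlock] at ih ⊢
    rw [ih]; ring

/-- Position of the coordinate gate of input `i` among coordinates starting at `base`. [folklore] -/
def coordRef (base i : ℕ) : ℕ := base + i * (k + 2) + (k + 1)

/-- Length of one chart block: coordinates, the use, the multiplier gate. [folklore] -/
def blockLen (B : KBlock) : ℕ := nIn k n * (k + 2) + (nIn k n + B.length + 1) + 1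

/-- **The gates of chart `a₀`** placed at `base`: the coordinate gates, a use of `B` behind them,
and the product `y_{a₀} · (output of the use)`. [cite: BlaserIkenmeyerLysikovPandeySchreyer2019, Thm. 40 (proof)] -/
def chartBlock (B : KBlock) (a₀ base : ℕ) : List (Gate ℤ (Fin (nVar k n))) :=
  coords k n a₀ base (nIn k n) ++
    useGatesRef (base + nIn k n * (k + 2)) (coordRef k base) (nIn k n) B ++
    [.prod [varOp _ (yIdx k n a₀), .gate (base + nIn k n * (k + 2) + useOut (nIn k n) B)]]

/-- Length of a chart block. [cite: Burgisser2000, Def. 2.1] -/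
@[simp] theorem length_chartBlock (B : KBlock) (a₀ base : ℕ) :
    (chartBlock k n B a₀ base).length = blockLen k n B := by
  simp only [chartBlock, blockLen, List.length_append, length_coords, length_useGatesRef,
    List.length_singleton]

/-- The gates of the charts `0, …, m-1`. [cite: BlaserIkenmeyerLysikovPandeySchreyer2019, Thm. 40 (proof)] -/
def charts (B : KBlock) (m : ℕ) : List (Gate ℤ (Fin (nVar k n))) :=
  (List.range m).flatMap fun a₀ => chartBlock k n B a₀ (a₀ * blockLen k n B)

/-- Length of the chart gates. [cite: Burgisser2000, Def. 2.1] -/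
@[simp] theorem length_charts (B : KBlock) (m : ℕ) : (charts k n B m).length = m * blockLen k n B := by
  induction m with
  | zero => simp [charts]
  | succ m ih =>
    simp only [charts, List.range_succ, List.flatMap_append, List.flatMap_singleton, List.length_append,
      length_chartBlock] at ih ⊢
    rw [ih]; ring

/-- The final gate `Σ_{a₀ < k} 1 • (multiplier gate of chart a₀)`. [cite: BlaserIkenmeyerLysikovPandeySchreyer2019, Thm. 40 (proof)] -/
def finalGate (B : KBlock) : Gate ℤ (Fin (nVar k n)) :=
  .sum ((List.range k).map fun a₀ => (1, .gate (a₀ * blockLen k n B + (blockLen k n B - 1))))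

/-- Ballast: `m` empty gates (so that the code word is at least as long as the number of
variables). [folklore] -/
def ballast (M m : ℕ) : List (Gate ℤ (Fin M)) := List.replicate m (Gate.sum [])

/-- **The chart-test circuit** of the guessed block `B`: `Σ_{a₀} y_{a₀} · B(φ_{a₀})`, followed by
the ballast. [cite: BlaserIkenmeyerLysikovPandeySchreyer2019, Thm. 40 (proof: "check whether C(g_1, …, g_{p(n)}) is identically zero")] -/
def chartCircuit (B : KBlock) : ArithCircuit ℤ (Fin (nVar k n)) where
  gates := charts k n B k ++ [finalGate k n B] ++ ballast (nVar k n) (nVar k n)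
  output := .gate (k * blockLen k n B)

/-! #### Semantics of the chart-test circuit -/

/-- The polynomial of the coordinate `(a, b, c)` (`i = a n² + b n + c`) of chart `a₀`:
`u_b v_c − Σ_{a' < k, a' ≠ a₀} x_{a'} S_{a' b c}` if `a = a₀`, else `S_{abc}`.
[cite: BlaserIkenmeyerLysikovPandeySchreyer2019, Thm. 40 (proof: the parametrisation g_1, …, g_{p(n)})] -/
def coordPoly (a₀ i : ℕ) : MvPolynomial (Fin (nVar k n)) ℤ :=
  if i / n ^ 2 = a₀ then
    varP _ (uIdx k n ((i / n) % n)) * varP _ (vIdx k n (i % n)) -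
      ∑ a' ∈ (Finset.range k).erase a₀,
        varP _ (xIdx k n a') * varP _ (a' * n ^ 2 + ((i / n) % n) * n + i % n)
  else varP _ i

/-- The values of the `k + 1` product gates of a coordinate block. [folklore] -/
def prodVals (i : ℕ) : List (MvPolynomial (Fin (nVar k n)) ℤ) :=
  (varP _ (uIdx k n ((i / n) % n)) * varP _ (vIdx k n (i % n))) ::
    (List.range k).map (fun a' => varP _ (xIdx k n a') * varP _ (a' * n ^ 2 + ((i / n) % n) * n + i % n))

/-- Length of the product values. [cite: Burgisser2000, Def. 2.1] -/
@[simp] theorem length_prodVals (i : ℕ) : (prodVals k n i).length = k + 1 := by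
  simp [prodVals]

/-- The values of a coordinate block: the `k + 1` products and the coordinate. [folklore] -/
def coordBlockVals (a₀ i : ℕ) : List (MvPolynomial (Fin (nVar k n)) ℤ) :=
  prodVals k n i ++ [coordPoly k n a₀ i]

/-- Length of the values of a coordinate block. [cite: Burgisser2000, Def. 2.1] -/
@[simp] theorem length_coordBlockVals (a₀ i : ℕ) : (coordBlockVals k n a₀ i).length = k + 2 := by
  simp [coordBlockVals]

/-- The product gates are value-independent and compute `prodVals`. [folklore] -/
private theorem gateValues_append_prods (pre : List (Gate ℤ (Fin (nVar k n)))) (i : ℕ) :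
    gateValues (pre ++ prodUV k n i :: (List.range k).map (prodXS k n i)) = gateValues pre ++ prodVals k n i := by
  rw [gateValues_append_of_forall pre _ (fun g => g.eval []) (fun g hg vals => ?_)]
  · simp [prodUV, prodXS, prodVals, Gate.eval, Function.comp_def]
  · simp only [List.mem_cons, List.mem_map, List.mem_range] at hg
    rcases hg with rfl | ⟨a', -, rfl⟩ <;> simp [prodUV, prodXS, Gate.eval]

/-- **The coordinate gate computes the coordinate polynomial** when its products sit right before
it. [cite: BlaserIkenmeyerLysikovPandeySchreyer2019, Thm. 40 (proof: the parametrisation)] -/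
theorem eval_coordGate (V : List (MvPolynomial (Fin (nVar k n)) ℤ)) (a₀ i : ℕ) :
    (coordGate k n a₀ i V.length).eval (V ++ prodVals k n i) = coordPoly k n a₀ i := by
  have hget : ∀ j, (V ++ prodVals k n i).getD (V.length + j) 0 = (prodVals k n i).getD j 0 := fun j => by
    rw [List.getD_eq_getElem?_getD, List.getD_eq_getElem?_getD, List.getElem?_append_right (by omega),
      Nat.add_sub_cancel_left]
  have hget0 : (V ++ prodVals k n i).getD V.length 0 =
      varP _ (uIdx k n ((i / n) % n)) * varP _ (vIdx k n (i % n)) := by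
    have := hget 0
    rw [Nat.add_zero] at this
    rw [this]
    simp [prodVals]
  have hgetS : ∀ a' < k, (V ++ prodVals k n i).getD (V.length + 1 + a') 0 =
      varP _ (xIdx k n a') * varP _ (a' * n ^ 2 + ((i / n) % n) * n + i % n) := fun a' ha' => by
    rw [Nat.add_assoc, hget (1 + a'), Nat.add_comm 1 a']
    simp [prodVals, List.getD_eq_getElem?_getD, List.getElem?_range ha']
  unfold coordGate coordPoly
  split_ifs with ha
  · simp only [Gate.eval, List.map_cons, List.map_map, Function.comp_def, Operand.eval_gate, List.sum_cons,
      one_smul, hget0]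
    rw [sub_eq_add_neg]
    congr 1
    have hsum : ((List.range k).map fun a' => (if a' = a₀ then (0 : ℤ) else -1) •
        (V ++ prodVals k n i).getD (V.length + 1 + a') 0).sum =
        ∑ a' ∈ Finset.range k, (if a' = a₀ then (0 : ℤ) else -1) •
          (varP (nVar k n) (xIdx k n a') * varP _ (a' * n ^ 2 + ((i / n) % n) * n + i % n)) := by
      rw [← List.toFinset_range, List.sum_toFinset _ (List.nodup_range)]
      refine congrArg List.sum (List.map_congr_left fun a' ha' => ?_)
      rw [hgetS a' (List.mem_range.1 ha')]
    rw [hsum, ← Finset.sum_erase (Finset.range k) (a := a₀) (by simp), ← Finset.sum_neg_distrib]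
    exact Finset.sum_congr rfl fun a' ha' => by simp [(Finset.mem_erase.1 ha').1]
  · simp [Gate.eval]

/-- **Values of a coordinate block** placed at its own position. [folklore] -/
private theorem gateValues_append_coordBlock (pre : List (Gate ℤ (Fin (nVar k n)))) (a₀ i : ℕ) :
    gateValues (pre ++ coordBlock k n a₀ i pre.length) = gateValues pre ++ coordBlockVals k n a₀ i := by
  rw [coordBlock, ← List.cons_append, ← List.append_assoc, gateValues_append_singleton,
    gateValues_append_prods, coordBlockVals, List.append_assoc]
  have hlen : (gateValues pre).length = pre.length := gateValues_length pre
  congr 2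
  have := eval_coordGate k n (gateValues pre) a₀ i
  rw [hlen] at this
  rw [this]

/-- Unfolding `coords` by one input position. [cite: BlaserIkenmeyerLysikovPandeySchreyer2019, Thm. 40 (proof)] -/
theorem coords_succ (a₀ base m : ℕ) :
    coords k n a₀ base (m + 1) = coords k n a₀ base m ++ coordBlock k n a₀ m (base + m * (k + 2)) := by
  simp [coords, List.range_succ, List.flatMap_append]

/-- **Values of the coordinate gates** placed at their own position. [folklore] -/
private theorem gateValues_append_coords (pre : List (Gate ℤ (Fin (nVar k n)))) (a₀ m : ℕ) :
    gateValues (pre ++ coords k n a₀ pre.length m) =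
      gateValues pre ++ (List.range m).flatMap (coordBlockVals k n a₀) := by
  induction m with
  | zero => simp [coords]
  | succ m ih =>
    rw [coords_succ, ← List.append_assoc,
      show pre.length + m * (k + 2) = (pre ++ coords k n a₀ pre.length m).length by simp,
      gateValues_append_coordBlock, ih, List.range_succ, List.flatMap_append, List.flatMap_singleton,
      List.append_assoc]

/-- Reading inside a concatenation of blocks of constant length. [folklore] -/
private theorem getD_flatMap_range {α : Type*} (f : ℕ → List α) {L : ℕ} (hf : ∀ i, (f i).length = L) (d : α)
    {m i j : ℕ} (hi : i < m) (hj : j < L) :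
    ((List.range m).flatMap f).getD (i * L + j) d = (f i).getD j d := by
  induction m with
  | zero => exact absurd hi (Nat.not_lt_zero _)
  | succ m ih =>
    have hlen : ((List.range m).flatMap f).length = m * L := by
      clear hi ih
      induction m with
      | zero => simp
      | succ m ih => simp [List.range_succ, List.flatMap_append, ih, hf]; ring
    rw [List.range_succ, List.flatMap_append, List.flatMap_singleton, List.getD_eq_getElem?_getD,
      List.getD_eq_getElem?_getD]
    rcases Nat.lt_succ_iff_lt_or_eq.1 hi with h | rfl
    · rw [List.getElem?_append_left (by rw [hlen]; nlinarith), ← List.getD_eq_getElem?_getD,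
        ← List.getD_eq_getElem?_getD, ih h]
    · rw [List.getElem?_append_right (by rw [hlen]; omega), hlen, Nat.add_sub_cancel_left]

/-- **The coordinate gate of input `i` holds `coordPoly a₀ i`.** [cite: BlaserIkenmeyerLysikovPandeySchreyer2019, Thm. 40 (proof)] -/
theorem valueAt_coords (pre post : List (Gate ℤ (Fin (nVar k n)))) (a₀ : ℕ) {m i : ℕ} (hi : i < m) :
    valueAt (pre ++ coords k n a₀ pre.length m ++ post) (coordRef k pre.length i) = coordPoly k n a₀ i := by
  have hlt : coordRef k pre.length i < (pre ++ coords k n a₀ pre.length m).length := by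
    simp only [coordRef, List.length_append, length_coords]
    have : (i + 1) * (k + 2) ≤ m * (k + 2) := Nat.mul_le_mul_right _ hi
    nlinarith
  rw [valueAt_append_left _ _ hlt, valueAt, gateValues_append_coords, coordRef, Nat.add_assoc,
    getD_gateValues_append, getD_flatMap_range (coordBlockVals k n a₀) (L := k + 2)
      (length_coordBlockVals k n a₀) 0 hi (by omega)]
  simp [coordBlockVals, List.getD_eq_getElem?_getD, length_prodVals]

/-- **Value of a chart block**: its last gate holds `y_{a₀} · blockPoly(coordinates of chart a₀)`.
[cite: BlaserIkenmeyerLysikovPandeySchreyer2019, Thm. 40 (proof)] -/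
theorem valueAt_chartBlock (pre post : List (Gate ℤ (Fin (nVar k n)))) (B : KBlock) (a₀ : ℕ) :
    valueAt (pre ++ chartBlock k n B a₀ pre.length ++ post) (pre.length + (blockLen k n B - 1)) =
      varP _ (yIdx k n a₀) * aeval (fun i : Fin (nIn k n) => coordPoly k n a₀ i) (blockPoly (nIn k n) B) := by
  have hL : pre.length + (blockLen k n B - 1) =
      (pre ++ coords k n a₀ pre.length (nIn k n) ++
        useGatesRef (pre.length + nIn k n * (k + 2)) (coordRef k pre.length) (nIn k n) B).length := by
    simp [blockLen]
  rw [valueAt_append_left _ _ (by simp [blockLen]), chartBlock, ← List.append_assoc, ← List.append_assoc, hL,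
    valueAt_append_singleton]
  simp only [Gate.eval, List.map_cons, List.map_nil, List.prod_cons, List.prod_nil, mul_one, eval_varOp,
    Operand.eval_gate]
  congr 1
  have hpre : pre.length + nIn k n * (k + 2) = (pre ++ coords k n a₀ pre.length (nIn k n)).length := by simp
  rw [hpre, ← valueAt, ← List.append_nil (pre ++ coords k n a₀ pre.length (nIn k n) ++ useGatesRef _ _ _ _),
    valueAt_useGatesRef _ [] (fun i hi => ?_) B]
  · have hfun : (fun i : Fin (nIn k n) => valueAt (pre ++ coords k n a₀ pre.length (nIn k n)) (coordRef k pre.length i)) =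
        fun i : Fin (nIn k n) => coordPoly k n a₀ i := funext fun i => by
      rw [← List.append_nil (pre ++ coords k n a₀ pre.length (nIn k n)), valueAt_coords k n pre [] a₀ i.isLt]
    rw [hfun]
  · simp only [coordRef, List.length_append, length_coords]
    have : (i + 1) * (k + 2) ≤ nIn k n * (k + 2) := Nat.mul_le_mul_right _ hi
    nlinarith

/-- Unfolding `charts` by one chart. [cite: BlaserIkenmeyerLysikovPandeySchreyer2019, Thm. 40 (proof)] -/
theorem charts_succ (B : KBlock) (m : ℕ) :
    charts k n B (m + 1) = charts k n B m ++ chartBlock k n B m (m * blockLen k n B) := by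
  simp [charts, List.range_succ, List.flatMap_append]

/-- **Value of the multiplier gate of chart `a₀`** inside the chart gates. [cite: BlaserIkenmeyerLysikovPandeySchreyer2019, Thm. 40 (proof)] -/
theorem valueAt_charts (B : KBlock) {m a₀ : ℕ} (ha : a₀ < m) :
    valueAt (charts k n B m) (a₀ * blockLen k n B + (blockLen k n B - 1)) =
      varP _ (yIdx k n a₀) * aeval (fun i : Fin (nIn k n) => coordPoly k n a₀ i) (blockPoly (nIn k n) B) := by
  induction m with
  | zero => exact absurd ha (Nat.not_lt_zero _)
  | succ m ih =>
    rw [charts_succ]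
    rcases Nat.lt_succ_iff_lt_or_eq.1 ha with h | rfl
    · rw [valueAt_append_left _ _ ?_, ih h]
      rw [length_charts]
      have h1 : (a₀ + 1) * blockLen k n B ≤ m * blockLen k n B := Nat.mul_le_mul_right _ h
      have h2 : 0 < blockLen k n B := by simp [blockLen]
      rw [Nat.succ_mul] at h1
      generalize a₀ * blockLen k n B = P at *
      generalize m * blockLen k n B = Q at *
      omega
    · have h := valueAt_chartBlock k n (charts k n B a₀) [] B a₀
      rw [List.append_nil, length_charts] at h
      exact h

/-- **The chart-test circuit computes `Σ_{a₀ < k} y_{a₀} · blockPoly(φ_{a₀})`.**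
[cite: BlaserIkenmeyerLysikovPandeySchreyer2019, Thm. 40 (proof: "C(g_1, …, g_{p(n)})")] -/
theorem eval_chartCircuit (B : KBlock) :
    (chartCircuit k n B).eval = ∑ a₀ ∈ Finset.range k,
      varP _ (yIdx k n a₀) * aeval (fun i : Fin (nIn k n) => coordPoly k n a₀ i) (blockPoly (nIn k n) B) := by
  change (Operand.gate (k * blockLen k n B) : Operand ℤ _).eval
    (gateValues (charts k n B k ++ [finalGate k n B] ++ ballast (nVar k n) (nVar k n))) = _
  rw [eval_gate_eq_valueAt, valueAt_append_left _ _ (by simp),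
    show k * blockLen k n B = (charts k n B k).length by simp, valueAt_append_singleton]
  simp only [finalGate, Gate.eval, List.map_map, Function.comp_def, one_smul, eval_gate_eq_valueAt]
  rw [← List.toFinset_range, List.sum_toFinset _ List.nodup_range]
  exact congrArg List.sum (List.map_congr_left fun a₀ ha₀ => valueAt_charts k n B (List.mem_range.1 ha₀))

/-- Size of the chart-test circuit. [cite: Burgisser2000, Def. 2.1] -/
theorem size_chartCircuit (B : KBlock) :
    (chartCircuit k n B).size = k * blockLen k n B + 1 + nVar k n := by
  simp only [chartCircuit, size, ballast, List.length_append, length_charts, List.length_singleton,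
    List.length_replicate]

/-! #### The chart sum vanishes iff every chart substitution does -/

/-- Number of chart variables (`S, x, u, v`): the multipliers `y_a` come after them. [folklore] -/
def nLow : ℕ := k * n ^ 2 + k + n + n

/-- `nVar = nLow + k`. [cite: BlaserIkenmeyerLysikovPandeySchreyer2019, Thm. 40 (proof)] -/
theorem nVar_eq : nVar k n = nLow k n + k := rfl

/-- `varP` in range is the variable. [cite: Burgisser2000, Def. 2.1] -/
theorem varP_of_lt {M i : ℕ} (h : i < M) : varP M i = X ⟨i, h⟩ := by
  unfold varP; rw [dif_pos h]

/-- An algebra map fixing the low variables fixes `varP i` for low `i`. [folklore] -/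
private theorem aeval_varP_of_fix {f : Fin (nVar k n) → MvPolynomial (Fin (nVar k n)) ℤ}
    (hf : ∀ j : Fin (nVar k n), j.val < nLow k n → f j = X j) {i : ℕ} (hi : i < nLow k n) :
    aeval f (varP (nVar k n) i) = varP (nVar k n) i := by
  have hi' : i < nVar k n := by rw [nVar_eq]; omega
  rw [varP_of_lt hi', aeval_X, hf _ hi]

/-- **The coordinate polynomials only involve the chart variables**: an algebra map fixing the
variables below `nLow` fixes them (input position `i < N`). [folklore] -/
private theorem aeval_coordPoly_of_fix {f : Fin (nVar k n) → MvPolynomial (Fin (nVar k n)) ℤ}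
    (hf : ∀ j : Fin (nVar k n), j.val < nLow k n → f j = X j) (a₀ : ℕ) {i : ℕ} (hi : i < nIn k n) :
    aeval f (coordPoly k n a₀ i) = coordPoly k n a₀ i := by
  have hn : 0 < n := by
    rcases Nat.eq_zero_or_pos n with rfl | h
    · simp [nIn] at hi
    · exact h
  have hb : (i / n) % n < n := Nat.mod_lt _ hn
  have hc : i % n < n := Nat.mod_lt _ hn
  have hN : i < nLow k n := by unfold nIn at hi; unfold nLow; omega
  have hu : uIdx k n ((i / n) % n) < nLow k n := by unfold uIdx nLow; omega
  have hv : vIdx k n (i % n) < nLow k n := by unfold vIdx nLow; omega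
  have hx : ∀ a' < k, xIdx k n a' < nLow k n := fun a' ha' => by unfold xIdx nLow; omega
  have hS : ∀ a' < k, a' * n ^ 2 + ((i / n) % n) * n + i % n < nLow k n := fun a' ha' => by
    unfold nLow
    have h1 : a' * n ^ 2 + ((i / n) % n) * n + i % n < (a' + 1) * n ^ 2 := by
      have : ((i / n) % n) * n + i % n < n * n := by nlinarith
      nlinarith
    have h2 : (a' + 1) * n ^ 2 ≤ k * n ^ 2 := Nat.mul_le_mul_right _ ha'
    omega
  unfold coordPoly
  split_ifs with ha
  · rw [map_sub, map_mul, map_sum, aeval_varP_of_fix k n hf hu, aeval_varP_of_fix k n hf hv]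
    congr 1
    refine Finset.sum_congr rfl fun a' ha' => ?_
    have ha'k : a' < k := Finset.mem_range.1 (Finset.mem_of_mem_erase ha')
    rw [map_mul, aeval_varP_of_fix k n hf (hx a' ha'k), aeval_varP_of_fix k n hf (hS a' ha'k)]
  · exact aeval_varP_of_fix k n hf hN

/-- The substitution selecting the chart `a₀`: low variables fixed, `y_{a₀} ↦ 1`, other `y ↦ 0`. [folklore] -/
def selY (a₀ : ℕ) (j : Fin (nVar k n)) : MvPolynomial (Fin (nVar k n)) ℤ :=
  if j.val < nLow k n then X j else if j.val = nLow k n + a₀ then 1 else 0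

/-- `selY` on a multiplier variable. [folklore] -/
private theorem aeval_selY_varP_yIdx (a₀ a : ℕ) (ha : a < k) :
    aeval (selY k n a₀) (varP (nVar k n) (yIdx k n a)) = if a = a₀ then 1 else 0 := by
  have hy : yIdx k n a < nVar k n := by unfold yIdx nVar; omega
  rw [varP_of_lt hy, aeval_X]
  unfold selY yIdx nLow
  simp only
  rw [if_neg (by omega)]
  by_cases h : a = a₀
  · subst h; simp
  · rw [if_neg (by omega), if_neg h]

/-- **The chart sum vanishes iff every chart substitution of the block polynomial vanishes**
(the multipliers `y_{a₀}` are fresh variables). [cite: BlaserIkenmeyerLysikovPandeySchreyer2019, Thm. 40 (proof: one identity test per generator tuple)] -/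
theorem eval_chartCircuit_eq_zero_iff (B : KBlock) :
    (chartCircuit k n B).eval = 0 ↔
      ∀ a₀ < k, aeval (fun i : Fin (nIn k n) => coordPoly k n a₀ i) (blockPoly (nIn k n) B) = 0 := by
  rw [eval_chartCircuit]
  refine ⟨fun h a₀ ha₀ => ?_, fun h => Finset.sum_eq_zero fun a₀ ha₀ => by
    rw [h a₀ (Finset.mem_range.1 ha₀), mul_zero]⟩
  have hfix : ∀ j : Fin (nVar k n), j.val < nLow k n → selY k n a₀ j = X j := fun j hj => by
    unfold selY; rw [if_pos hj]
  have hQ : ∀ a, aeval (selY k n a₀) (aeval (fun i : Fin (nIn k n) => coordPoly k n a i) (blockPoly (nIn k n) B)) =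
      aeval (fun i : Fin (nIn k n) => coordPoly k n a i) (blockPoly (nIn k n) B) := fun a => by
    rw [comp_aeval_apply]
    have hfun : (fun i : Fin (nIn k n) => aeval (selY k n a₀) (coordPoly k n a i)) =
        fun i : Fin (nIn k n) => coordPoly k n a i := by
      funext i
      have hi : (i : ℕ) < nIn k n := i.isLt
      exact aeval_coordPoly_of_fix k n hfix a hi
    rw [hfun]
  have h' := congrArg (aeval (selY k n a₀)) h
  rw [map_sum, map_zero] at h'
  rw [← h']
  symm
  rw [Finset.sum_eq_single_of_mem a₀ (Finset.mem_range.2 ha₀) fun a ha hne => by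
    rw [map_mul, aeval_selY_varP_yIdx k n a₀ a (Finset.mem_range.1 ha), if_neg hne, zero_mul]]
  rw [map_mul, aeval_selY_varP_yIdx k n a₀ a₀ ha₀, if_pos rfl, one_mul, hQ]

end Chart

/-! ### §5. The evaluation circuit -/

section Eval

/-- **The evaluation circuit**: the guessed block behind the constant layer `c` (no variables),
output = the output of the use. [cite: BlaserIkenmeyerLysikovPandeySchreyer2019, Thm. 40 (proof: "we can check whether f(v) ≠ 0")] -/
def evalCircuit (N : ℕ) (c : ℕ → ℤ) (B : KBlock) : ArithCircuit ℤ (Fin 0) where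
  gates := useGates 0 (fun i : Fin N => LayerEntry.const (c i)) B
  output := .gate (useOut N B)

/-- Constant substitutions are constants. [folklore] -/
private theorem aeval_C_comp {σ τ : Type*} (c : σ → ℤ) (q : MvPolynomial σ ℤ) :
    aeval (fun i => (C (c i) : MvPolynomial τ ℤ)) q = C (eval c q) := by
  induction q using MvPolynomial.induction_on with
  | C a => simp
  | add p q hp hq => simp only [map_add, hp, hq]
  | mul_X p i hp => simp only [map_mul, hp, aeval_X, eval_X]

/-- **The evaluation circuit computes the value of `blockPoly` at `c`.**
[cite: BlaserIkenmeyerLysikovPandeySchreyer2019, Thm. 40 (proof)] -/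
theorem eval_evalCircuit (N : ℕ) (c : ℕ → ℤ) (B : KBlock) :
    (evalCircuit N c B).eval = C (eval (fun i : Fin N => c i) (blockPoly N B)) := by
  change (Operand.gate (useOut N B) : Operand ℤ (Fin 0)).eval
    (gateValues (useGates 0 (fun i : Fin N => LayerEntry.const (c i)) B)) = _
  rw [eval_gate_eq_valueAt, ← aeval_C_comp]
  have h := valueAt_useGates ([] : List (Gate ℤ (Fin 0))) [] (fun i : Fin N => LayerEntry.const (c i)) B
  simpa [LayerEntry.toPoly] using h

/-- The evaluation circuit vanishes iff the value does. [cite: BlaserIkenmeyerLysikovPandeySchreyer2019, Thm. 40 (proof)] -/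
theorem eval_evalCircuit_eq_zero_iff (N : ℕ) (c : ℕ → ℤ) (B : KBlock) :
    (evalCircuit N c B).eval = 0 ↔ eval (fun i : Fin N => c i) (blockPoly N B) = 0 := by
  rw [eval_evalCircuit, C_eq_zero]

/-- Size of the evaluation circuit. [cite: Burgisser2000, Def. 2.1] -/
theorem size_evalCircuit (N : ℕ) (c : ℕ → ℤ) (B : KBlock) :
    (evalCircuit N c B).size = N + B.length + 1 := by
  simp [evalCircuit, size]

/-- **The zero-padded tensor of an instance, as a function of the input position**: entry
`i = a n'² + b n' + c` (`n' = n + n₀`) is the instance entry `l[a n² + b n + c]` if `b, c < n`, else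
`0` (the `n × n` slices padded to `n' × n'`; cf. `hmrTensorOfList`).
[cite: BlaserIkenmeyerLysikovPandeySchreyer2019, Problem 2 (input) and Lemma 16 (padding)] -/
def padEntry (n n₀ : ℕ) (l : List ℤ) (i : ℕ) : ℤ :=
  if (i / (n + n₀)) % (n + n₀) < n ∧ i % (n + n₀) < n then
    l.getD (i / (n + n₀) ^ 2 * n ^ 2 + (i / (n + n₀)) % (n + n₀) * n + i % (n + n₀)) 0
  else 0

end Eval

/-! ### §6. Completeness: descending an honest sign-constant circuit to a guessed block -/

section Descent

variable {F : Type*} [Field F]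

open Classical in
/-- The integer reading of a sign constant: `1 ↦ 1`, `-1 ↦ -1`, everything else `↦ 0`. [folklore] -/
def signInt (c : F) : ℤ := if c = 1 then 1 else if c + 1 = 0 then -1 else 0

/-- `signInt c` is always a sign constant. [cite: Burgisser2000, §4.1] -/
theorem isSignConstant_signInt (c : F) : IsSignConstant (signInt c) := by
  unfold signInt IsSignConstant
  split_ifs <;> simp

/-- A sign constant is recovered from its integer reading (characteristic `0` not needed).
[cite: Burgisser2000, §4.1] -/
theorem cast_signInt {c : F} (hc : IsSignConstant c) : ((signInt c : ℤ) : F) = c := by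
  unfold signInt
  rcases hc with rfl | rfl | h
  · have h01 : (0 : F) ≠ 1 := zero_ne_one
    have h02 : ¬ ((0 : F) + 1 = 0) := by rw [zero_add]; exact one_ne_zero
    rw [if_neg h01, if_neg h02]; simp
  · simp
  · have hc1 : c = -1 := eq_neg_of_add_eq_zero_left h
    subst hc1
    by_cases h1 : (-1 : F) = 1
    · rw [if_pos h1, h1]; simp
    · rw [if_neg h1, if_pos (by ring)]; simp

/-- The constants of a sign-constant operand are sign constants. [cite: Burgisser2000, §4.1] -/
theorem Operand.isSignConstant_of_mem_consts {σ : Type*} {u : Operand F σ} (hu : u.HasSignConstants)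
    {c : F} (hc : c ∈ u.consts) : IsSignConstant c := by
  cases u with
  | var i => simp [Operand.consts] at hc
  | const d =>
    simp only [Operand.consts, List.mem_singleton] at hc
    subst hc; exact hu
  | gate j => simp [Operand.consts] at hc

/-- The constants of a sign-constant gate are sign constants. [cite: Burgisser2000, §4.1] -/
theorem Gate.isSignConstant_of_mem_consts {σ : Type*} {g : Gate F σ} (hg : g.HasSignConstants)
    {c : F} (hc : c ∈ g.consts) : IsSignConstant c := by
  cases g with
  | sum args =>
    simp only [Gate.consts, List.mem_append, List.mem_map, List.mem_flatMap] at hc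
    rcases hc with ⟨a, ha, rfl⟩ | ⟨a, ha, hca⟩
    · exact (hg a ha).1
    · exact Operand.isSignConstant_of_mem_consts (hg a ha).2 hca
  | prod args =>
    simp only [Gate.consts, List.mem_flatMap] at hc
    obtain ⟨u, hu, hcu⟩ := hc
    exact Operand.isSignConstant_of_mem_consts (hg u hu) hcu

/-- The constants of a sign-constant circuit are sign constants. [cite: Burgisser2000, §4.1] -/
theorem isSignConstant_of_mem_consts {σ : Type*} {P : ArithCircuit F σ} (hP : P.HasSignConstants)
    {c : F} (hc : c ∈ P.consts) : IsSignConstant c := by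
  simp only [consts, List.mem_append, List.mem_flatMap] at hc
  rcases hc with ⟨g, hg, hcg⟩ | hc
  · exact Gate.isSignConstant_of_mem_consts (hP.1 g hg) hcg
  · exact Operand.isSignConstant_of_mem_consts hP.2 hc

/-- Changing constants along `signInt` yields a sign-constant circuit. [cite: Burgisser2000, §4.1] -/
theorem hasSignConstants_mapConsts_signInt {σ : Type*} (P : ArithCircuit F σ) :
    (P.mapConsts (signInt (F := F))).HasSignConstants := by
  have hop : ∀ u : Operand F σ, (u.map (signInt (F := F))).HasSignConstants := fun u => by
    cases u with
    | var i => trivial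
    | const d => exact isSignConstant_signInt d
    | gate j => trivial
  refine ⟨fun g hg => ?_, hop P.output⟩
  simp only [ArithCircuit.mapConsts, List.mem_map] at hg
  obtain ⟨g', -, rfl⟩ := hg
  cases g' with
  | sum args =>
    intro a ha
    simp only [List.mem_map] at ha
    obtain ⟨a', -, rfl⟩ := ha
    exact ⟨isSignConstant_signInt a'.1, hop a'.2⟩
  | prod args =>
    intro u hu
    simp only [List.mem_map] at hu
    obtain ⟨u', -, rfl⟩ := hu
    exact hop u'

/-- **Descent of a natural proof to a guessed block**: a fan-in-two sign-constant circuit over a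
field, in `N` variables, is computed — after reading its constants in `ℤ` — by a guessed gate list of
length `size + 1` whose references stay inside its use. [cite: BlaserIkenmeyerLysikovPandeySchreyer2019, Cor. 42 (proof: "the family (𝓜_r) is p-definable")] -/
theorem exists_kblock_of_circuit {N : ℕ} (P : ArithCircuit F (Fin N)) (h2 : P.IsFanInTwo)
    (hs : P.HasSignConstants) :
    ∃ B : KBlock, B.length = P.size + 1 ∧
      (∀ g ∈ B, g.a.idx < N + B.length ∧ g.b.idx < N + B.length) ∧
      map (Int.castRingHom F) (blockPoly N B) = P.eval := by
  set Pz : ArithCircuit ℤ (Fin N) := P.mapConsts (signInt (F := F)) with hPz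
  refine ⟨toKBlockFin Pz, by simp [hPz], fun g hg => idx_lt_of_mem_toKBlockFin Pz hg, ?_⟩
  rw [blockPoly_toKBlockFin Pz (h2.mapConsts _) (hasSignConstants_mapConsts_signInt P),
    ← eval_map_apply, hPz, map_mapConsts_eq_self]
  exact fun c hc => cast_signInt (isSignConstant_of_mem_consts hs hc)

end Descent

end BILPS2019Cor42

end Literature.Barriers.ValiantsHypothesis
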